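import Summits.BirchSwinnertonDyer.Rank1Residual.P2.KrizLiNineSeventyTwo
import HarnessLib

/-!
# Cell `bsd-print-cf2` (D-0131 (2) PRINT TIER, leaf CornerF @ `p = 2`), typer ty2 — the (★)-CERTIFIED
# Kriz–Li bases `1728a1 : y² = x³ + 2` and `1728v1 : y² = x³ − 2` (`j = 0`, ADDITIVE at `2`, type II,
# `K = ℚ(√−23)`) in the SETTING of Kriz–Li 2019 Thm 5.1 (2), every kernel-checkable hypothesis DISCHARGED

HONEST FRAMING. Sequel of `P2/KrizLiNineSeventyTwo.lean` (same framing and dictionary) for the two bases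
of conductor `1728 = 2⁶·3³`: `1728a1 : y² = x³ + 2` (generator `(−1, 1)`) and `1728v1 : y² = x³ − 2`
(generator `(3, 5)`), Kodaira type II at `2` (`f₂ = 6`, `c₂ = 1`), CM by `ℤ[ζ₃]`, `2` inert, analytic rank
one, with Assumption (★) CERTIFIED (not printed) at `K = ℚ(√−23)` by the cell's lit seat (dossier §14.4,
kit j282459). DISCHARGED IN THE KERNEL per base: global minimality; `E(ℚ)[2] = 0` (modulo `7`); from the
tree's Tate algorithm at `2`: `ord₂ N = 6`, `c₂` odd, additive at `2` (Manin clause live: from an odd Manin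
constant of the displayed parametrisation / Agashe–Ribet–Stein BY NAME for an optimal one); `N ∣ 1728`
(`< 5000`) and `N = 3ᵏ·2⁶`, whence the sign clause for `d > 0`, `d ≡ 1 (mod 12)`; a rational point of
infinite order; the Heegner hypothesis K-generically and at `d_K = −23`; the prime support of `2N`; the
decidable form of "`a_ℓ` odd"; the placement of the twists by `d ≡ 1 (mod 4)` (CM, `2` inert, NOT good
at `2`: INERT-BAD quadrant of crux `InertJZeroOfFacts`, stmt-BirchSwinnertonDyer-20671). No named fact;
nothing beyond kernel theorems about two explicit curves; the leaf is OPEN AS A CLASS; (★) stays the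
consumer's displayed binder.

References: [KrizLi2019] Thm 5.1 (2) = arXiv:1606.03172 Thm 1.12, Def 4.1, Thm 4.3, Rem. 6.3;
[SilvermanATAEC1994] IV.9.4, Table 4.1, IV.10, IV.11.1; [Cremona1997] Table 1 (1728a1, 1728v1);
[SilvermanAEC2009] VII.1, VII.3.4, VII.5.1, VIII.6.7; [AgasheRibetStein2006] Thm 2.6; [Marcus1977]
Ch. 3 Thm 25; [CreutzMiller2012] Thm 1.1; cell dossier §14.4.
-/

noncomputable section

open scoped Classical

open WeierstrassCurve NumberField Literature.NumberTheory.EllipticCurves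
  Literature.NumberTheory.EllipticCurves.Rank1Residual
  Literature.NumberTheory.EllipticCurves.ModularForms
  Summit.BirchSwinnertonDyer.Rank1Residual IsDedekindDomain Rat.HeightOneSpectrum

set_option autoImplicit false

namespace Summit.BirchSwinnertonDyer.Rank1Residual.P2

open Summit.BirchSwinnertonDyer.BirchSwinnertonDyer.Theorems.ConductorBoundOfBadPrimes
  Literature.NumberTheory.EllipticCurves.Rank1Residual.X11RankOneCertificates IsDedekindDomain
  Literature.NumberTheory.DiophantineGeometry

/-! ## §1 `1728a1 : y² = x³ + 2` (`N = 1728`; Kodaira II at `2`, `f₂ = 6`) -/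

/-- **Cremona's `1728a1 = [0,0,0,0,2]`** (`Δ = −432·2²`; generator `(−1, 1)`; rank `1`; (★)
certified at `K = ℚ(√−23)`, cell dossier §14.4 — NOT printed). [cite: Cremona1997, Table 1 (curve 1728a1)] -/
abbrev curve1728a1 : WeierstrassCurve ℚ := ⟨0, 0, 0, 0, 2⟩

/-- The integer model of `1728a1`. [folklore] -/
def curve1728a1Int : WeierstrassCurve ℤ := ⟨0, 0, 0, 0, 2⟩

/-- The integer model maps to the rational one. [folklore] -/
theorem curve1728a1Int_map : curve1728a1Int.map (Int.castRingHom ℚ) = curve1728a1 := by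
  ext <;> simp [curve1728a1Int, WeierstrassCurve.map]

/-- `Δ` of the integer model. [folklore] -/
theorem curve1728a1Int_Δ : curve1728a1Int.Δ = -432 * 2 ^ 2 := by
  simp only [curve1728a1Int, WeierstrassCurve.Δ, WeierstrassCurve.b₂, WeierstrassCurve.b₄, WeierstrassCurve.b₆,
    WeierstrassCurve.b₈]
  norm_num

/-- `1728a1` is literally `⟨0, 0, 0, 0, (2 : ℤ)⟩` cast. [folklore] -/
theorem curve1728a1_eq : curve1728a1 = ⟨((0 : ℤ) : ℚ), ((0 : ℤ) : ℚ), ((0 : ℤ) : ℚ), ((0 : ℤ) : ℚ), ((2 : ℤ) : ℚ)⟩ := by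
  push_cast; rfl

/-- `1728a1` is an elliptic curve. [folklore] -/
instance isElliptic_curve1728a1 : curve1728a1.IsElliptic := isElliptic_of_j_zero_model (by norm_num)

/-- **`1728a1` is globally minimal** (Kraus–Silverman certificate at `2` and `3`). [cite: SilvermanAEC2009, VII.1 Remark 1.1] [cite: Kraus1989, Prop. 2] -/
instance isGloballyMinimal_curve1728a1 : curve1728a1.IsGloballyMinimal :=
  X11b.isGloballyMinimal_of_krausCriterion_support 0 0 0 0 2 [(2, 6, 6), (3, 3, 3)]
    (by intro t ht; simp only [List.mem_cons, List.not_mem_nil, or_false] at ht; rcases ht with rfl | rfl <;> norm_num)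
    (by decide +kernel) (by decide +kernel)

/-- **`1728a1(ℚ)[2] = 0`**: modulo the good prime `7` there is no affine `2`-torsion point (`x³ = −2` has no
root in `𝔽_7`). [cite: KrizLi2019, Thm. 5.1 hypothesis "E(ℚ)[2] = 0"] [cite: SilvermanAEC2009, Prop. VII.3.1(b)] -/
theorem twoTorsion_curve1728a1 : ∀ Q : curve1728a1.toAffine.Point, 2 • Q = 0 → Q = 0 := by
  rw [← curve1728a1Int_map]
  haveI : Fact (Nat.Prime 7) := ⟨by norm_num⟩
  have hΔ : ¬ ((7 : ℕ) : ℤ) ∣ curve1728a1Int.Δ := by rw [curve1728a1Int_Δ]; norm_num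
  have hB : twoTorsionNoneB curve1728a1Int 7 = true := by decide +kernel
  exact fun Q hQ => twoTorsion_eq_zero_of_twoTorsionNoneB curve1728a1Int 7 hΔ (by norm_num) hB Q hQ

/-- **At `2`: `ord₂ N(1728a1) = 6`, `c₂` odd, additive** (Kodaira II; Tate's algorithm in the tree).
[cite: SilvermanATAEC1994, IV.9.4 and Table 4.1] -/
theorem at_two_curve1728a1 :
    haveI : Fact (Nat.Prime 2) := ⟨Nat.prime_two⟩
    (curve1728a1.conductorNorm ℤ).factorization 2 = 6 ∧
      Odd ((curve1728a1.baseChange ℚ_[2]).localTamagawaNumber ℤ_[2]) ∧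
      curve1728a1.HasAdditiveReductionAt placeTwo𝓞 ∧ ¬ curve1728a1.HasGoodReductionAtPrime 2 ∧
      ¬ curve1728a1.HasMultiplicativeReductionAtPrime 2 :=
  krizLi_at_two_mordell_two_mul curve1728a1 rfl rfl rfl rfl (u := 1) (by decide) (by push_cast; norm_num)

/-- **`N(1728a1) ∣ 1728`**: Ogg's bounds `f₂ ≤ 8`, `f₃ ≤ 5` sharpened by the exact `f₂ = 6`.
[cite: Silverman1994, IV.10.4 and IV.11.1] -/
theorem conductorNorm_curve1728a1_dvd : curve1728a1.conductorNorm ℤ ∣ 1728 := by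
  have h : curve1728a1.conductorNorm ℤ ∣ 1728 :=
    conductorNorm_dvd_of_localBounds 0 0 0 0 2 curve1728a1 curve1728a1_eq [(2, 6), (3, 3)]
      (by intro t ht; simp only [List.mem_cons, List.not_mem_nil, or_false] at ht; rcases ht with rfl | rfl <;> norm_num)
      (by decide +kernel) (by norm_num) (by decide +kernel)
  have h' := dvd_three_pow_mul_pow_of_factorization (i := 3) (a := 6) Nat.prime_two
    (by simpa using h) at_two_curve1728a1.1
  simpa using h'

/-- `N(1728a1) < 5000` (Creutz–Miller's range). [folklore] -/
theorem conductorNorm_curve1728a1_lt : curve1728a1.conductorNorm ℤ < 5000 :=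
  lt_of_le_of_lt (Nat.le_of_dvd (by norm_num) conductorNorm_curve1728a1_dvd) (by norm_num)

/-- `N(1728a1) ≠ 0`. [folklore] -/
instance neZero_conductorNorm_curve1728a1 : NeZero (curve1728a1.conductorNorm ℤ) :=
  ⟨(curve1728a1.conductorNorm_pos_holds).ne'⟩

/-- **`N(1728a1) = 3ᵏ · 2^6`** for some `k` (Cremona: `N = 1728`, not needed). [cite: Cremona1997, Table 1 (1728a1)] -/
theorem conductorNorm_curve1728a1_eq : ∃ k, curve1728a1.conductorNorm ℤ = 3 ^ k * 2 ^ 6 :=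
  eq_three_pow_mul_pow_of_dvd (i := 3) Nat.prime_two (by norm_num) (by simpa using conductorNorm_curve1728a1_dvd)
    at_two_curve1728a1.1

/-- A prime `ℓ ∉ {2, 3}` does not divide `2N(1728a1)`. [folklore] -/
theorem not_dvd_two_mul_conductorNorm_curve1728a1 {ℓ : ℕ} (hℓ : ℓ.Prime) (h2 : ℓ ≠ 2) (h3 : ℓ ≠ 3) :
    ¬ ℓ ∣ 2 * curve1728a1.conductorNorm ℤ := by
  intro h
  have h' : ℓ ∣ 2 * 1728 := h.trans (mul_dvd_mul_left 2 conductorNorm_curve1728a1_dvd)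
  have h'' : ℓ ∣ 2 ^ 7 * 3 ^ 5 := h'.trans (by norm_num)
  rcases (Nat.Prime.dvd_mul hℓ).mp h'' with h | h
  · exact h2 ((Nat.prime_dvd_prime_iff_eq hℓ Nat.prime_two).mp (hℓ.dvd_of_dvd_pow h))
  · exact h3 ((Nat.prime_dvd_prime_iff_eq hℓ Nat.prime_three).mp (hℓ.dvd_of_dvd_pow h))

/-- **Kriz–Li's local clause for `1728a1`, given an odd Manin constant of the displayed parametrisation.**
[cite: KrizLi2019, Thm. 5.1 hypotheses "c₂(E) odd; if E has additive reduction at 2, its Manin constant is odd"] -/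
theorem krizLi_loc_curve1728a1 {N : ℕ} [NeZero N] (Dt : ModularParametrizationData curve1728a1 N) (hc : Odd Dt.c) :
    haveI : Fact (2 : ℕ).Prime := ⟨Nat.prime_two⟩
    Odd ((curve1728a1.baseChange ℚ_[2]).localTamagawaNumber ℤ_[2]) ∧
      (¬ curve1728a1.HasGoodReductionAtPrime 2 → ¬ curve1728a1.HasMultiplicativeReductionAtPrime 2 → Odd Dt.c) :=
  krizLi_loc_of_odd curve1728a1 Dt at_two_curve1728a1.2.1 hc

/-- **The Manin constant of an OPTIMAL parametrisation of `1728a1` is odd** (Agashe–Ribet–Stein / Cremona,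
`N ≤ 130000`, BY NAME `hARS`): discharges `hc` of `krizLi_loc_curve1728a1` for a displayed optimal datum.
[cite: AgasheRibetStein2006, Thm. 2.6 (Cremona: c_E = 1 for optimal curves of conductor ≤ 130000)] -/
theorem odd_c_of_isOptimalDatum_curve1728a1 (hARS : AgasheRibetStein2006.cremona_abs_maninConstant_eq_one_of_level_le)
    (Dt : ModularParametrizationData curve1728a1 (curve1728a1.conductorNorm ℤ))
    (hopt : ShuZhai2021.IsOptimalDatum curve1728a1 Dt) : Odd Dt.c := by
  have h2 := not_two_dvd_c_of_isOptimalDatum_of_conductorNorm_le hARS Dt hopt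
    (conductorNorm_curve1728a1_lt.le.trans (by norm_num))
  exact Int.odd_iff.mpr (Int.emod_two_ne_zero.mp fun h0 => h2 (Int.dvd_of_emod_eq_zero h0))

/-- **`1 ≤ rank_ℤ 1728a1(ℚ)` IN THE KERNEL**: `3·(−1, 1)` has `x = 127 / 441` with the odd prime
`3 ∣ 441`. [cite: SilvermanAEC2009, VII.3.4 and Thm. VIII.6.7] [cite: Cremona1997, Table 1 (1728a1: r = 1)] -/
theorem one_le_mordellWeilRank_curve1728a1 : 1 ≤ curve1728a1.mordellWeilRank := by
  haveI : Fact (Nat.Prime 3) := ⟨by norm_num⟩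
  exact one_le_mordellWeilRank_of_dvd_den curve1728a1 3 (by norm_num) (x := 127 / 441) (y := 13175 / 9261)
    (WeierstrassCurve.Affine.equation_iff_nonsingular.mp (by
      rw [WeierstrassCurve.Affine.equation_iff]; norm_num))
    (by norm_num)

/-- **The Heegner hypothesis for `N(1728a1)` in ANY quadratic `K` with `d_K ≡ 1 (mod 8)` and `(d_K/3) = 1`**
(`2` and `3`, the primes of `N`, split). [cite: KrizLi2019, Thm. 5.1 hypothesis "K satisfies the Heegner hypothesis for N"] -/
theorem satisfiesHeegnerHypothesis_curve1728a1 {K : Type} [Field K] [NumberField K]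
    (h2 : Module.finrank ℚ K = 2) (h8 : NumberField.discr K % 8 = 1) (h3 : jacobiSym (NumberField.discr K) 3 = 1) :
    SatisfiesHeegnerHypothesis (curve1728a1.conductorNorm ℤ) K := by
  refine satisfiesHeegnerHypothesis_of_dvd h2 conductorNorm_curve1728a1_dvd (fun q hq hqB hq2 => ?_) (fun _ => h8)
  have h'' : q ∣ 2 ^ 6 * 3 ^ 5 := hqB.trans (by norm_num)
  rcases (Nat.Prime.dvd_mul hq).mp h'' with h | h
  · exact absurd ((Nat.prime_dvd_prime_iff_eq hq Nat.prime_two).mp (hq.dvd_of_dvd_pow h)) hq2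
  · rw [(Nat.prime_dvd_prime_iff_eq hq Nat.prime_three).mp (hq.dvd_of_dvd_pow h)]; exact h3

/-- **Heegner hypothesis for `(1728a1, K)`, `d_K = −23`.** [cite: KrizLi2019, Thm. 5.1 hypothesis "K satisfies the Heegner hypothesis for N"] [cite: Marcus1977, Ch. 3 Thm. 25] -/
theorem satisfiesHeegnerHypothesis_curve1728a1_of_discr_eq {K : Type} [Field K] [NumberField K]
    (h2 : Module.finrank ℚ K = 2) (hdK : NumberField.discr K = -23) :
    SatisfiesHeegnerHypothesis (curve1728a1.conductorNorm ℤ) K :=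
  satisfiesHeegnerHypothesis_curve1728a1 h2 (by rw [hdK]; decide) (by rw [hdK]; norm_num)

/-- **`a_ℓ(1728a1)` odd `⟺` an even number of cube roots of `-2` in `𝔽_ℓ`** (`ℓ ∉ {2,3}`).
[cite: KrizLi2019, Def. 4.1 ("Frob_ℓ of order 3", a_ℓ odd)] -/
theorem odd_frobeniusTrace_curve1728a1_iff {ℓ : ℕ} [NeZero ℓ] (hℓ : ℓ.Prime) (h2 : ℓ ≠ 2) (h3 : ℓ ≠ 3) :
    Odd (curve1728a1.frobeniusTrace ℓ) ↔ Even ((Finset.univ.filter fun x : ZMod ℓ => x ^ 3 = -2).card) := by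
  have hk : ¬ (ℓ : ℤ) ∣ 2 := by
    intro h
    have hℓp : Prime (ℓ : ℤ) := Nat.prime_iff_prime_int.mp hℓ
    have h' : (ℓ : ℤ) ∣ 2 ^ 4 * 3 ^ 2 := h.trans (by norm_num)
    rcases hℓp.dvd_or_dvd h' with h | h
    · exact h2 ((Nat.prime_dvd_prime_iff_eq hℓ Nat.prime_two).mp
        (Int.natCast_dvd_natCast.mp (by exact_mod_cast hℓp.dvd_of_dvd_pow h)))
    · exact h3 ((Nat.prime_dvd_prime_iff_eq hℓ Nat.prime_three).mp
        (Int.natCast_dvd_natCast.mp (by exact_mod_cast hℓp.dvd_of_dvd_pow h)))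
  have h := odd_frobeniusTrace_of_eq_sextic_iff curve1728a1 2 (by push_cast; rfl) hℓ h2
    (not_dvd_Δ_sexticInt hℓ h2 h3 hk)
  push_cast at h
  simpa using h

/-- **The sign clause `χ_d(−N) = 1` for `1728a1`** for positive `d ≡ 1 (mod 12)` (`N = 3ᵏ·2^6`, `f₂` even).
[cite: KrizLi2019, Thm. 5.1 (2) condition "χ_d(−N) = 1"] -/
theorem sign_mul_jacobiSym_conductorNorm_curve1728a1 {d : ℤ} (hd0 : 0 < d) (hd12 : d % 12 = 1) :
    Int.sign d * jacobiSym (curve1728a1.conductorNorm ℤ) d.natAbs = 1 := by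
  obtain ⟨k, hk⟩ := conductorNorm_curve1728a1_eq
  exact sign_mul_jacobiSym_eq_one_of_eq_three_pow_mul_two_pow (k := k) (m := 3) (hk.trans (by norm_num)) hd0 hd12

/-- **The twists of `1728a1` by `d ≡ 1 (mod 4)` are ADDITIVE at `2` on every model** (`y² = x³ + 2d³`
has the same `2`-adic shape as the base): the family lies in the INERT-BAD quadrant; with CM and `2` inert.
[cite: SilvermanATAEC1994, IV.9.4] [cite: Cox2013, §5.B Prop. 5.16] -/
theorem placement_of_smul_twist_curve1728a1 {d : ℤ} (hd4 : d % 4 = 1) {W : WeierstrassCurve ℚ} [W.IsElliptic]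
    {C : VariableChange ℚ} (hC : C • curve1728a1.quadraticTwist (d : ℚ) = W) :
    W.HasCM ∧ CMInert W 2 ∧ ¬ Good W 2 := by
  have hd0 : (d : ℚ) ≠ 0 := by exact_mod_cast (show d ≠ 0 by omega)
  obtain ⟨hcm, hin⟩ := hasCM_and_cmInert_two_of_smul_twist_sextic (k := 2) (by norm_num) hd0 hC
  refine ⟨hcm, hin, not_good_two_of_smul_twist_sextic hC ?_⟩
  haveI : (⟨0, 0, 0, 0, (d : ℚ) ^ 3 * 2⟩ : WeierstrassCurve ℚ).IsElliptic :=
    isElliptic_of_j_zero_model (mul_ne_zero (pow_ne_zero 3 hd0) (by norm_num))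
  exact (krizLi_at_two_mordell_two_mul ⟨0, 0, 0, 0, (d : ℚ) ^ 3 * 2⟩ rfl rfl rfl rfl (u := 1 * d ^ 3)
    (by rw [one_mul]; exact fun h => by have := Int.prime_two.dvd_of_dvd_pow h; omega) (by push_cast; ring)).2.2.2.1

/-! ## §2 `1728v1 : y² = x³ − 2` (`N = 1728`; Kodaira II at `2`, `f₂ = 6`) -/

/-- **Cremona's `1728v1 = [0,0,0,0,-2]`** (`Δ = −432·-2²`; generator `(3, 5)`; rank `1`; (★)
certified at `K = ℚ(√−23)`, cell dossier §14.4 — NOT printed). [cite: Cremona1997, Table 1 (curve 1728v1)] -/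
abbrev curve1728v1 : WeierstrassCurve ℚ := ⟨0, 0, 0, 0, -2⟩

/-- The integer model of `1728v1`. [folklore] -/
def curve1728v1Int : WeierstrassCurve ℤ := ⟨0, 0, 0, 0, -2⟩

/-- The integer model maps to the rational one. [folklore] -/
theorem curve1728v1Int_map : curve1728v1Int.map (Int.castRingHom ℚ) = curve1728v1 := by
  ext <;> simp [curve1728v1Int, WeierstrassCurve.map]

/-- `Δ` of the integer model. [folklore] -/
theorem curve1728v1Int_Δ : curve1728v1Int.Δ = -432 * (-2) ^ 2 := by
  simp only [curve1728v1Int, WeierstrassCurve.Δ, WeierstrassCurve.b₂, WeierstrassCurve.b₄, WeierstrassCurve.b₆,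
    WeierstrassCurve.b₈]
  norm_num

/-- `1728v1` is literally `⟨0, 0, 0, 0, (-2 : ℤ)⟩` cast. [folklore] -/
theorem curve1728v1_eq : curve1728v1 = ⟨((0 : ℤ) : ℚ), ((0 : ℤ) : ℚ), ((0 : ℤ) : ℚ), ((0 : ℤ) : ℚ), ((-2 : ℤ) : ℚ)⟩ := by
  push_cast; rfl

/-- `1728v1` is an elliptic curve. [folklore] -/
instance isElliptic_curve1728v1 : curve1728v1.IsElliptic := isElliptic_of_j_zero_model (by norm_num)

/-- **`1728v1` is globally minimal** (Kraus–Silverman certificate at `2` and `3`). [cite: SilvermanAEC2009, VII.1 Remark 1.1] [cite: Kraus1989, Prop. 2] -/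
instance isGloballyMinimal_curve1728v1 : curve1728v1.IsGloballyMinimal :=
  X11b.isGloballyMinimal_of_krausCriterion_support 0 0 0 0 (-2) [(2, 6, 6), (3, 3, 3)]
    (by intro t ht; simp only [List.mem_cons, List.not_mem_nil, or_false] at ht; rcases ht with rfl | rfl <;> norm_num)
    (by decide +kernel) (by decide +kernel)

/-- **`1728v1(ℚ)[2] = 0`**: modulo the good prime `7` there is no affine `2`-torsion point (`x³ = −-2` has no
root in `𝔽_7`). [cite: KrizLi2019, Thm. 5.1 hypothesis "E(ℚ)[2] = 0"] [cite: SilvermanAEC2009, Prop. VII.3.1(b)] -/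
theorem twoTorsion_curve1728v1 : ∀ Q : curve1728v1.toAffine.Point, 2 • Q = 0 → Q = 0 := by
  rw [← curve1728v1Int_map]
  haveI : Fact (Nat.Prime 7) := ⟨by norm_num⟩
  have hΔ : ¬ ((7 : ℕ) : ℤ) ∣ curve1728v1Int.Δ := by rw [curve1728v1Int_Δ]; norm_num
  have hB : twoTorsionNoneB curve1728v1Int 7 = true := by decide +kernel
  exact fun Q hQ => twoTorsion_eq_zero_of_twoTorsionNoneB curve1728v1Int 7 hΔ (by norm_num) hB Q hQ

/-- **At `2`: `ord₂ N(1728v1) = 6`, `c₂` odd, additive** (Kodaira II; Tate's algorithm in the tree).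
[cite: SilvermanATAEC1994, IV.9.4 and Table 4.1] -/
theorem at_two_curve1728v1 :
    haveI : Fact (Nat.Prime 2) := ⟨Nat.prime_two⟩
    (curve1728v1.conductorNorm ℤ).factorization 2 = 6 ∧
      Odd ((curve1728v1.baseChange ℚ_[2]).localTamagawaNumber ℤ_[2]) ∧
      curve1728v1.HasAdditiveReductionAt placeTwo𝓞 ∧ ¬ curve1728v1.HasGoodReductionAtPrime 2 ∧
      ¬ curve1728v1.HasMultiplicativeReductionAtPrime 2 :=
  krizLi_at_two_mordell_two_mul curve1728v1 rfl rfl rfl rfl (u := -1) (by decide) (by push_cast; norm_num)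

/-- **`N(1728v1) ∣ 1728`**: Ogg's bounds `f₂ ≤ 8`, `f₃ ≤ 5` sharpened by the exact `f₂ = 6`.
[cite: Silverman1994, IV.10.4 and IV.11.1] -/
theorem conductorNorm_curve1728v1_dvd : curve1728v1.conductorNorm ℤ ∣ 1728 := by
  have h : curve1728v1.conductorNorm ℤ ∣ 1728 :=
    conductorNorm_dvd_of_localBounds 0 0 0 0 (-2) curve1728v1 curve1728v1_eq [(2, 6), (3, 3)]
      (by intro t ht; simp only [List.mem_cons, List.not_mem_nil, or_false] at ht; rcases ht with rfl | rfl <;> norm_num)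
      (by decide +kernel) (by norm_num) (by decide +kernel)
  have h' := dvd_three_pow_mul_pow_of_factorization (i := 3) (a := 6) Nat.prime_two
    (by simpa using h) at_two_curve1728v1.1
  simpa using h'

/-- `N(1728v1) < 5000` (Creutz–Miller's range). [folklore] -/
theorem conductorNorm_curve1728v1_lt : curve1728v1.conductorNorm ℤ < 5000 :=
  lt_of_le_of_lt (Nat.le_of_dvd (by norm_num) conductorNorm_curve1728v1_dvd) (by norm_num)

/-- `N(1728v1) ≠ 0`. [folklore] -/
instance neZero_conductorNorm_curve1728v1 : NeZero (curve1728v1.conductorNorm ℤ) :=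
  ⟨(curve1728v1.conductorNorm_pos_holds).ne'⟩

/-- **`N(1728v1) = 3ᵏ · 2^6`** for some `k` (Cremona: `N = 1728`, not needed). [cite: Cremona1997, Table 1 (1728v1)] -/
theorem conductorNorm_curve1728v1_eq : ∃ k, curve1728v1.conductorNorm ℤ = 3 ^ k * 2 ^ 6 :=
  eq_three_pow_mul_pow_of_dvd (i := 3) Nat.prime_two (by norm_num) (by simpa using conductorNorm_curve1728v1_dvd)
    at_two_curve1728v1.1

/-- A prime `ℓ ∉ {2, 3}` does not divide `2N(1728v1)`. [folklore] -/
theorem not_dvd_two_mul_conductorNorm_curve1728v1 {ℓ : ℕ} (hℓ : ℓ.Prime) (h2 : ℓ ≠ 2) (h3 : ℓ ≠ 3) :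
    ¬ ℓ ∣ 2 * curve1728v1.conductorNorm ℤ := by
  intro h
  have h' : ℓ ∣ 2 * 1728 := h.trans (mul_dvd_mul_left 2 conductorNorm_curve1728v1_dvd)
  have h'' : ℓ ∣ 2 ^ 7 * 3 ^ 5 := h'.trans (by norm_num)
  rcases (Nat.Prime.dvd_mul hℓ).mp h'' with h | h
  · exact h2 ((Nat.prime_dvd_prime_iff_eq hℓ Nat.prime_two).mp (hℓ.dvd_of_dvd_pow h))
  · exact h3 ((Nat.prime_dvd_prime_iff_eq hℓ Nat.prime_three).mp (hℓ.dvd_of_dvd_pow h))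

/-- **Kriz–Li's local clause for `1728v1`, given an odd Manin constant of the displayed parametrisation.**
[cite: KrizLi2019, Thm. 5.1 hypotheses "c₂(E) odd; if E has additive reduction at 2, its Manin constant is odd"] -/
theorem krizLi_loc_curve1728v1 {N : ℕ} [NeZero N] (Dt : ModularParametrizationData curve1728v1 N) (hc : Odd Dt.c) :
    haveI : Fact (2 : ℕ).Prime := ⟨Nat.prime_two⟩
    Odd ((curve1728v1.baseChange ℚ_[2]).localTamagawaNumber ℤ_[2]) ∧
      (¬ curve1728v1.HasGoodReductionAtPrime 2 → ¬ curve1728v1.HasMultiplicativeReductionAtPrime 2 → Odd Dt.c) :=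
  krizLi_loc_of_odd curve1728v1 Dt at_two_curve1728v1.2.1 hc

/-- **The Manin constant of an OPTIMAL parametrisation of `1728v1` is odd** (Agashe–Ribet–Stein / Cremona,
`N ≤ 130000`, BY NAME `hARS`): discharges `hc` of `krizLi_loc_curve1728v1` for a displayed optimal datum.
[cite: AgasheRibetStein2006, Thm. 2.6 (Cremona: c_E = 1 for optimal curves of conductor ≤ 130000)] -/
theorem odd_c_of_isOptimalDatum_curve1728v1 (hARS : AgasheRibetStein2006.cremona_abs_maninConstant_eq_one_of_level_le)
    (Dt : ModularParametrizationData curve1728v1 (curve1728v1.conductorNorm ℤ))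
    (hopt : ShuZhai2021.IsOptimalDatum curve1728v1 Dt) : Odd Dt.c := by
  have h2 := not_two_dvd_c_of_isOptimalDatum_of_conductorNorm_le hARS Dt hopt
    (conductorNorm_curve1728v1_lt.le.trans (by norm_num))
  exact Int.odd_iff.mpr (Int.emod_two_ne_zero.mp fun h0 => h2 (Int.dvd_of_emod_eq_zero h0))

/-- **`1 ≤ rank_ℤ 1728v1(ℚ)` IN THE KERNEL**: `2·(3, 5)` has `x = 129 / 100` with the odd prime
`5 ∣ 100`. [cite: SilvermanAEC2009, VII.3.4 and Thm. VIII.6.7] [cite: Cremona1997, Table 1 (1728v1: r = 1)] -/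
theorem one_le_mordellWeilRank_curve1728v1 : 1 ≤ curve1728v1.mordellWeilRank := by
  haveI : Fact (Nat.Prime 5) := ⟨by norm_num⟩
  exact one_le_mordellWeilRank_of_dvd_den curve1728v1 5 (by norm_num) (x := 129 / 100) (y := -383 / 1000)
    (WeierstrassCurve.Affine.equation_iff_nonsingular.mp (by
      rw [WeierstrassCurve.Affine.equation_iff]; norm_num))
    (by norm_num)

/-- **The Heegner hypothesis for `N(1728v1)` in ANY quadratic `K` with `d_K ≡ 1 (mod 8)` and `(d_K/3) = 1`**
(`2` and `3`, the primes of `N`, split). [cite: KrizLi2019, Thm. 5.1 hypothesis "K satisfies the Heegner hypothesis for N"] -/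
theorem satisfiesHeegnerHypothesis_curve1728v1 {K : Type} [Field K] [NumberField K]
    (h2 : Module.finrank ℚ K = 2) (h8 : NumberField.discr K % 8 = 1) (h3 : jacobiSym (NumberField.discr K) 3 = 1) :
    SatisfiesHeegnerHypothesis (curve1728v1.conductorNorm ℤ) K := by
  refine satisfiesHeegnerHypothesis_of_dvd h2 conductorNorm_curve1728v1_dvd (fun q hq hqB hq2 => ?_) (fun _ => h8)
  have h'' : q ∣ 2 ^ 6 * 3 ^ 5 := hqB.trans (by norm_num)
  rcases (Nat.Prime.dvd_mul hq).mp h'' with h | h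
  · exact absurd ((Nat.prime_dvd_prime_iff_eq hq Nat.prime_two).mp (hq.dvd_of_dvd_pow h)) hq2
  · rw [(Nat.prime_dvd_prime_iff_eq hq Nat.prime_three).mp (hq.dvd_of_dvd_pow h)]; exact h3

/-- **Heegner hypothesis for `(1728v1, K)`, `d_K = −23`.** [cite: KrizLi2019, Thm. 5.1 hypothesis "K satisfies the Heegner hypothesis for N"] [cite: Marcus1977, Ch. 3 Thm. 25] -/
theorem satisfiesHeegnerHypothesis_curve1728v1_of_discr_eq {K : Type} [Field K] [NumberField K]
    (h2 : Module.finrank ℚ K = 2) (hdK : NumberField.discr K = -23) :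
    SatisfiesHeegnerHypothesis (curve1728v1.conductorNorm ℤ) K :=
  satisfiesHeegnerHypothesis_curve1728v1 h2 (by rw [hdK]; decide) (by rw [hdK]; norm_num)

/-- **`a_ℓ(1728v1)` odd `⟺` an even number of cube roots of `2` in `𝔽_ℓ`** (`ℓ ∉ {2,3}`).
[cite: KrizLi2019, Def. 4.1 ("Frob_ℓ of order 3", a_ℓ odd)] -/
theorem odd_frobeniusTrace_curve1728v1_iff {ℓ : ℕ} [NeZero ℓ] (hℓ : ℓ.Prime) (h2 : ℓ ≠ 2) (h3 : ℓ ≠ 3) :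
    Odd (curve1728v1.frobeniusTrace ℓ) ↔ Even ((Finset.univ.filter fun x : ZMod ℓ => x ^ 3 = 2).card) := by
  have hk : ¬ (ℓ : ℤ) ∣ -2 := by
    intro h
    have hℓp : Prime (ℓ : ℤ) := Nat.prime_iff_prime_int.mp hℓ
    have h' : (ℓ : ℤ) ∣ 2 ^ 4 * 3 ^ 2 := h.trans (by norm_num)
    rcases hℓp.dvd_or_dvd h' with h | h
    · exact h2 ((Nat.prime_dvd_prime_iff_eq hℓ Nat.prime_two).mp
        (Int.natCast_dvd_natCast.mp (by exact_mod_cast hℓp.dvd_of_dvd_pow h)))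
    · exact h3 ((Nat.prime_dvd_prime_iff_eq hℓ Nat.prime_three).mp
        (Int.natCast_dvd_natCast.mp (by exact_mod_cast hℓp.dvd_of_dvd_pow h)))
  have h := odd_frobeniusTrace_of_eq_sextic_iff curve1728v1 (-2) (by push_cast; rfl) hℓ h2
    (not_dvd_Δ_sexticInt hℓ h2 h3 hk)
  push_cast at h
  simpa using h

/-- **The sign clause `χ_d(−N) = 1` for `1728v1`** for positive `d ≡ 1 (mod 12)` (`N = 3ᵏ·2^6`, `f₂` even).
[cite: KrizLi2019, Thm. 5.1 (2) condition "χ_d(−N) = 1"] -/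
theorem sign_mul_jacobiSym_conductorNorm_curve1728v1 {d : ℤ} (hd0 : 0 < d) (hd12 : d % 12 = 1) :
    Int.sign d * jacobiSym (curve1728v1.conductorNorm ℤ) d.natAbs = 1 := by
  obtain ⟨k, hk⟩ := conductorNorm_curve1728v1_eq
  exact sign_mul_jacobiSym_eq_one_of_eq_three_pow_mul_two_pow (k := k) (m := 3) (hk.trans (by norm_num)) hd0 hd12

/-- **The twists of `1728v1` by `d ≡ 1 (mod 4)` are ADDITIVE at `2` on every model** (`y² = x³ + -2d³`
has the same `2`-adic shape as the base): the family lies in the INERT-BAD quadrant; with CM and `2` inert.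
[cite: SilvermanATAEC1994, IV.9.4] [cite: Cox2013, §5.B Prop. 5.16] -/
theorem placement_of_smul_twist_curve1728v1 {d : ℤ} (hd4 : d % 4 = 1) {W : WeierstrassCurve ℚ} [W.IsElliptic]
    {C : VariableChange ℚ} (hC : C • curve1728v1.quadraticTwist (d : ℚ) = W) :
    W.HasCM ∧ CMInert W 2 ∧ ¬ Good W 2 := by
  have hd0 : (d : ℚ) ≠ 0 := by exact_mod_cast (show d ≠ 0 by omega)
  obtain ⟨hcm, hin⟩ := hasCM_and_cmInert_two_of_smul_twist_sextic (k := -2) (by norm_num) hd0 hC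
  refine ⟨hcm, hin, not_good_two_of_smul_twist_sextic hC ?_⟩
  haveI : (⟨0, 0, 0, 0, (d : ℚ) ^ 3 * -2⟩ : WeierstrassCurve ℚ).IsElliptic :=
    isElliptic_of_j_zero_model (mul_ne_zero (pow_ne_zero 3 hd0) (by norm_num))
  exact (krizLi_at_two_mordell_two_mul ⟨0, 0, 0, 0, (d : ℚ) ^ 3 * -2⟩ rfl rfl rfl rfl (u := -1 * d ^ 3)
    (by rw [neg_one_mul, dvd_neg]; exact fun h => by have := Int.prime_two.dvd_of_dvd_pow h; omega) (by push_cast; ring)).2.2.2.1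

end Summit.BirchSwinnertonDyer.Rank1Residual.P2
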